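import Summits.BirchSwinnertonDyer.BirchSwinnertonDyer.Theses.VerticalContact
import Summits.BirchSwinnertonDyer.BirchSwinnertonDyer.Theorems.TamePinch.Negative.CMQuarticImage
import Literature.NumberTheory.EllipticCurves.PAdicHeightsProofs
import Literature.NumberTheory.EllipticCurves.BSDSelmerParityDokchitserProofs
import Literature.NumberTheory.EllipticCurves.ComplexMultiplicationHasCMProofs

/-!
# Disproof of `PGSelmerBSD` (stmt-BirchSwinnertonDyer-17810) — findings: NO KILL; not vacuous
# (32a2 in the sector); no hypothesis load-bearing for truth (crux = summit's potentially-good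
# sector modulo Ш[p^∞]-finiteness at one prime); the ADMISSIBLE-prime strengthening is FALSE;
# a counterexample must have r_an ≥ 2 and an even gap ≥ 2 at EVERY prime

Standing crux disprover (refuter-cdisprove-stmt-BirchSwinnertonDyer-17810-0, cycle 1, 2026-08-17),
route VerticalContact. Prose only in docstrings; everything below is kernel-checked (0 sorry).
Inputs honoured: the crux-attack refuter's Probes (item evidence `Probes.lean`, SURVIVES verdict and
notes (i)/(ii)), the strategist's STRATEGY-CENSUS §Negation (N1)–(N3) and line `sector-split`, the
lead's PICKED (line `Sketch`, λ-minimal branch), `ledger negatives` (1 entry, 15532 TamePinch — its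
witness `32a2` is REUSED here through the landed `Theorems/TamePinch/Negative/CMQuarticImage`).

The crux: `∀ W elliptic, globally minimal, (¬ ∃ q prime, multiplicative at q) →
  ∃ p prime, corank_{ℤ_p} Sel_{p^∞}(W/ℚ) = ord_{s=1} L(W,s)`.

## Findings (section ↦ theorem)

1. READ-BACK `pgSelmerBSD_iff` (Iff.rfl). `selmerCorank = zpCorank (dim A[p] − dim A/pA, ℕ-sub)` of
   the genuine `p^∞`-Selmer group, made honest by the PROVED identity `corank = rank + corank Ш[p^∞]`;
   `analyticRank = analyticOrderNatAt entireLFunction 1`; `HasMultiplicativeReductionAtPrime` = Mathlib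
   reduction type of the `ℤ_q`-minimal model. `∃ p` carries NO side condition (p = 2, 3, bad,
   supersingular, small-image p all allowed). No junk operator bites.
2. SECTOR / NON-VACUITY. `not_exists_multiplicative_of_j_eq_intCast`: integral `j` ⟹ in the sector
   (via the tree theorem `one_lt_norm_j_of_hasMultiplicativeReductionAtPrime`, AEC VII.5.1(b));
   `thirtyTwoA2_no_multiplicative_prime`, `pgSelmerBSD_hypotheses_satisfiable`: `32a2 : y² = x³ − x`
   (`j = 1728`, `j_quartic`) is elliptic, globally minimal, in the sector — and CM (`hasCM_thirtyTwoA2`).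
   (The Lean sector "every bad prime additive" is wider than "integral j": it also holds additive
   potentially-multiplicative curves, refuter note (i) on the item; both kinds are genuine.)
3. LOAD-BEARING ANALYSIS (a). `PGSelmerBSDWithoutSector`, `PGSelmerBSDWithoutHypotheses` (sector and
   global minimality dropped) are still implied by `BirchSwinnertonDyer ∧ (∀ W ∃ p, Ш(W)[p^∞] finite)`
   (`pgSelmerBSDWithoutHypotheses_of_bsd_of_exists_finite_sha`, `…_of_bsd_of_shaPFinite`), hence NO
   `_false_without_<H>` theorem exists short of refuting BSD-rank or producing Ш infinite at every
   prime. Conversely `bsd_on_sector_of_pgSelmerBSD_of_shaPFinite`: crux ∧ item 0132 ⟹ summit on the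
   sector. So modulo 0132 the crux IS the potentially-good sector of the summit in Selmer language
   (`C ↛ S` off the sector only; `S → C` needs one-prime Ш-finiteness). `[W.IsElliptic]`: not
   attacked profitably — the only singular cubic with computed invariants in tree, the cusp `y² = x³`
   (`SqueezeUB/Negative`), has `analyticRank = 0` and `E_ns[p^∞](ℚ̄) = 0`, so it would satisfy the
   conclusion (corank 0), not defeat it.
4. COUNTEREXAMPLE SHAPE. `pgSelmerBSD_counterexample_dichotomy` (unconditional: at every prime,
   BSD-rank fails at `W` or `corank Ш(W)[p^∞] ≥ 1`); `pgSelmerBSD_counterexample_shape` (mod GZK +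
   `p`-parity: `r_an ≥ 2` and an EVEN gap `≥ 2` at every prime); `pgSelmerBSD_counterexample_sha_of_rank_eq`
   (if `rank = r_an` at `W`, then `corank Ш(W)[p^∞] ≥ 2` for ALL `p`); `pgSelmerBSD_iff_core` (mod GZK the
   crux ⟺ its `r_an ≥ 2` slice). No construction, heuristic or numerical signature of such a `W`
   exists; no kit job can refute (a refutation needs `corank_p ≠ r_an` at infinitely many `p`, and
   neither side is computable unconditionally) — instance CONFIRMATION only (Stein–Wuthrich pattern).
5. STRENGTHENINGS (c). FALSE: `pgSelmerBSD_strengthening_admissible_false` — "∃ ADMISSIBLE p (≥ 5, good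
   ordinary, ρ̄ onto) with corank_p = r_an" fails at `32a2` (no odd surjective prime:
   `pgSelmerBSD_strengthening_oddSurjective_false`; `pgSelmerBSD_sector_meets_CM`). So the shape of the
   multiplicative branch of `closes` (`hUBmult`) cannot be copied to this sector, and every line needs
   a CM branch. NOT refutable: `∃p ↦ ∀p` (`PGSelmerBSDForall`) and the uniform-prime version — both
   implied by `BSD ∧ SelmerRankShaPFinite` (`pgSelmerBSDForall_of_bsd_of_shaPFinite`,
   `pgSelmerBSD_uniform_of_bsd_of_shaPFinite`).
6. `-- Targets`: none served (payload.targets = []; skeleton `sector_split` has stubs = items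
   15878 / 0131 / 18086, each attacked on its own crux). `-- Line Sketch` (PICKED 2026-08-17, λ-minimal
   branch, C⁺ = `FreeOrderMinimalPrime`): not yet registered as a skeleton here; pre-attack notes in
   the docstring of `lineSketch_notes` below.

## Landed (Negative lane, importable)
* p158878 ACCEPTED — `Summits/…/Theorems/PGSelmerBSD/Negative/AdmissiblePrimeFalse.lean`
  (`PGSelmerBSDNegative.not_exists_multiplicative_of_j_eq_intCast`, `….thirtyTwoA2_no_multiplicative_prime`,
  `….hypotheses_satisfiable`, `….sector_meets_CM`, `….strengthening_admissible_false`,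
  `….strengthening_oddSurjective_false`, `….j_quartic`).
* p160738 ACCEPTED — `Summits/…/Theorems/PGSelmerBSD/Negative/CounterexampleShape.lean`
  (`PGSelmerBSDNegative.not_summit_or_sha_wild_of_not`, `….not_shaPFinite_of_summit_of_not`,
  `….counterexample_dichotomy`, `….counterexample_shape`, `….counterexample_sha_of_rank_eq`,
  `….exists_core_witness_of_not`).
The copies below (namespace `…Cruxes.PGSelmerBSD.Disproof`) are kept so this work-file stays
self-contained; import the Theorems modules in proofs.

## Why it resists (for provers)
The statement is BSD-strength on its sector and conjecturally TRUE; both sides of the equality are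
honest, non-computable invariants; the `∃ p` freedom makes it the weakest Selmer form of BSD-rank
(one prime per curve). The refuter's only levers — junk, vacuity, small models — are all closed:
(1) no junk, (2) sector inhabited, (3) the one small-model pattern of the negatives index (CM curve
without admissible prime) is neutralised by the side-condition-free `∃ p` and recorded as the false
strengthening of §5.
-/

set_option linter.dupNamespace false

noncomputable section

open scoped Classical

namespace Summit.BirchSwinnertonDyer.BirchSwinnertonDyer.Cruxes.PGSelmerBSD.Disproof

open Summit.BirchSwinnertonDyer.BirchSwinnertonDyer.Theses
open Summit.BirchSwinnertonDyer.BirchSwinnertonDyer.Theorems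
open Literature.NumberTheory.EllipticCurves WeierstrassCurve

/-! ### 1. Read-back -/

/-- The item is definitionally its verbatim signature. [folklore] -/
theorem pgSelmerBSD_iff :
    VerticalContact.PGSelmerBSD ↔
      ∀ (W : WeierstrassCurve ℚ) [W.IsElliptic] [W.IsGloballyMinimal],
        (¬ ∃ (q : ℕ) (_ : Fact q.Prime), W.HasMultiplicativeReductionAtPrime q) →
          ∃ (p : ℕ) (_ : Fact p.Prime), W.selmerCorank p = W.analyticRank :=
  Iff.rfl

/-! ### 2. The sector: integral `j` ⟹ no multiplicative prime; the witness `32a2` -/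

/-- `‖j(W)‖_q ≤ 1` excludes multiplicative reduction at `q` (contrapositive of the tree theorem
`one_lt_norm_j_of_hasMultiplicativeReductionAtPrime`, Silverman AEC VII.5.1(b)). [folklore] -/
theorem not_hasMultiplicativeReductionAtPrime_of_norm_j_le_one (W : WeierstrassCurve ℚ)
    [W.IsElliptic] (q : ℕ) [Fact q.Prime] (h : ‖(W.j : ℚ_[q])‖ ≤ 1) :
    ¬ W.HasMultiplicativeReductionAtPrime q := fun hm =>
  (not_lt.mpr h) (one_lt_norm_j_of_hasMultiplicativeReductionAtPrime hm)

/-- **Integral `j` ⟹ the curve is in the sector** (no prime of multiplicative reduction):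
`‖n‖_q ≤ 1` for an integer `n` at every prime `q`. [folklore] -/
theorem not_exists_multiplicative_of_j_eq_intCast (W : WeierstrassCurve ℚ) [W.IsElliptic]
    (n : ℤ) (hj : W.j = n) :
    ¬ ∃ (q : ℕ) (_ : Fact q.Prime), W.HasMultiplicativeReductionAtPrime q := by
  rintro ⟨q, hq, hm⟩
  refine not_hasMultiplicativeReductionAtPrime_of_norm_j_le_one W q ?_ hm
  rw [hj, Rat.cast_intCast]
  exact Padic.norm_int_le_one n

/-- `j(y² = x³ + Dx) = 1728` for `D ≠ 0` (`c₄ = −48D`, `Δ = −64D³`). [folklore] -/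
theorem j_quartic {D : ℚ} (hD : D ≠ 0) :
    @WeierstrassCurve.j ℚ _ (⟨0, 0, 0, D, 0⟩ : WeierstrassCurve ℚ) (isElliptic_quartic hD) = 1728 := by
  haveI := isElliptic_quartic hD
  have hΔ : (⟨0, 0, 0, D, 0⟩ : WeierstrassCurve ℚ).Δ = -64 * D ^ 3 := by
    simp only [WeierstrassCurve.Δ, WeierstrassCurve.b₂, WeierstrassCurve.b₄, WeierstrassCurve.b₆,
      WeierstrassCurve.b₈]
    ring
  have hc₄ : (⟨0, 0, 0, D, 0⟩ : WeierstrassCurve ℚ).c₄ = -48 * D := by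
    simp only [WeierstrassCurve.c₄, WeierstrassCurve.b₂, WeierstrassCurve.b₄]
    ring
  rw [WeierstrassCurve.j, Units.val_inv_eq_inv_val, coe_Δ', hΔ, hc₄]
  field_simp
  ring

/-- `32a2 = [0,0,0,−1,0]` (`y² = x³ − x`) is elliptic. [folklore] -/
instance isElliptic_thirtyTwoA2 : (⟨0, 0, 0, -1, 0⟩ : WeierstrassCurve ℚ).IsElliptic :=
  isElliptic_quartic (by norm_num)

/-- `32a2` is a global minimal model (landed: `tamePinch_isGloballyMinimal_thirtyTwoA2`). [folklore] -/
instance isGloballyMinimal_thirtyTwoA2 : (⟨0, 0, 0, -1, 0⟩ : WeierstrassCurve ℚ).IsGloballyMinimal :=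
  tamePinch_isGloballyMinimal_thirtyTwoA2

/-- `j(32a2) = 1728`. [folklore] -/
theorem j_thirtyTwoA2 : (⟨0, 0, 0, -1, 0⟩ : WeierstrassCurve ℚ).j = 1728 := by
  have := j_quartic (D := -1) (by norm_num)
  convert this

/-- **`32a2` lies in the sector**: no prime of multiplicative reduction (`j = 1728 ∈ ℤ`). [folklore] -/
theorem thirtyTwoA2_no_multiplicative_prime :
    ¬ ∃ (q : ℕ) (_ : Fact q.Prime),
      (⟨0, 0, 0, -1, 0⟩ : WeierstrassCurve ℚ).HasMultiplicativeReductionAtPrime q :=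
  not_exists_multiplicative_of_j_eq_intCast _ 1728 (by rw [j_thirtyTwoA2]; norm_num)

/-- **The hypotheses of `PGSelmerBSD` are jointly satisfiable** (the crux is not vacuous): `32a2`
is elliptic, globally minimal and has no multiplicative prime. [folklore] -/
theorem pgSelmerBSD_hypotheses_satisfiable :
    ∃ (W : WeierstrassCurve ℚ) (_ : W.IsElliptic) (_ : W.IsGloballyMinimal),
      ¬ ∃ (q : ℕ) (_ : Fact q.Prime), W.HasMultiplicativeReductionAtPrime q :=
  ⟨_, isElliptic_thirtyTwoA2, isGloballyMinimal_thirtyTwoA2, thirtyTwoA2_no_multiplicative_prime⟩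

/-- `32a2` has CM (`j = 1728`). [folklore] -/
theorem hasCM_thirtyTwoA2 : (⟨0, 0, 0, -1, 0⟩ : WeierstrassCurve ℚ).HasCM :=
  hasCM_of_j_eq_1728 _ j_thirtyTwoA2


/-! ### 3. Load-bearing analysis: NO hypothesis is load-bearing for truth (modulo BSD ∧ Ш) -/

/-- `PGSelmerBSD` with the SECTOR hypothesis dropped: one-prime Selmer-rank BSD for every elliptic
curve over `ℚ` in global minimal form. [folklore] -/
def PGSelmerBSDWithoutSector : Prop :=
  ∀ (W : WeierstrassCurve ℚ) [W.IsElliptic] [W.IsGloballyMinimal],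
    ∃ (p : ℕ) (_ : Fact p.Prime), W.selmerCorank p = W.analyticRank

/-- `PGSelmerBSD` with the sector hypothesis AND global minimality dropped. [folklore] -/
def PGSelmerBSDWithoutHypotheses : Prop :=
  ∀ (W : WeierstrassCurve ℚ) [W.IsElliptic], ∃ (p : ℕ) (_ : Fact p.Prime), W.selmerCorank p = W.analyticRank

/-- Dropping hypotheses only strengthens: `WithoutHypotheses ⟹ WithoutSector ⟹ PGSelmerBSD`. [folklore] -/
theorem pgSelmerBSDWithoutSector_of_withoutHypotheses (h : PGSelmerBSDWithoutHypotheses) :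
    PGSelmerBSDWithoutSector := fun W _ _ => h W

/-- `WithoutSector ⟹ PGSelmerBSD` (the sector hypothesis is never consumed). [folklore] -/
theorem pgSelmerBSD_of_withoutSector (h : PGSelmerBSDWithoutSector) : VerticalContact.PGSelmerBSD :=
  fun W _ _ _ => h W

/-- **`BSD ∧ (∀ W, ∃ p, Ш(W)[p^∞] finite) ⟹ PGSelmerBSDWithoutHypotheses`**: Greenberg's PROVED
identity `corank Sel_{p^∞} = rank + corank Ш[p^∞]` (`selmerCorank_eq_mordellWeilRank_add_holds`) and
`corank Ш[p^∞] = 0` for finite `Ш[p^∞]`. So NO `_false_without_<H>` theorem for `H ∈ {sector,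
IsGloballyMinimal}` can exist short of refuting BSD-rank or exhibiting a curve with `Ш[p^∞]`
infinite at EVERY prime. [cite: GreenbergLNM1716, §1] -/
theorem pgSelmerBSDWithoutHypotheses_of_bsd_of_exists_finite_sha (hS : _root_.BirchSwinnertonDyer)
    (hSha : ∀ (W : WeierstrassCurve ℚ) [W.IsElliptic],
      ∃ (p : ℕ) (_ : Fact p.Prime), Finite ↥(AddCommGroup.primaryComponent W.sha p)) :
    PGSelmerBSDWithoutHypotheses := by
  intro W _
  obtain ⟨p, hp, hfin⟩ := hSha W
  refine ⟨p, hp, ?_⟩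
  have h1 := W.selmerCorank_eq_mordellWeilRank_add_holds p
  have h2 : W.shaCorank p = 0 := Literature.BSD.shaCorank_eq_zero_of_finite W p hfin
  have h3 : W.analyticRank = W.mordellWeilRank :=
    (show ∀ V : WeierstrassCurve ℚ, V.IsElliptic → V.analyticRank = V.mordellWeilRank from hS) W ‹_›
  omega

/-- `BSD ∧ SelmerRankShaPFinite (item 0132 of this route) ⟹ PGSelmerBSDWithoutHypotheses`, at ANY
prescribed prime (here `p = 2`). [cite: GreenbergLNM1716, §1] -/
theorem pgSelmerBSDWithoutHypotheses_of_bsd_of_shaPFinite (hS : _root_.BirchSwinnertonDyer)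
    (hSha : VerticalContact.SelmerRankShaPFinite) : PGSelmerBSDWithoutHypotheses :=
  pgSelmerBSDWithoutHypotheses_of_bsd_of_exists_finite_sha hS fun W _ => ⟨2, ⟨Nat.prime_two⟩, hSha W 2⟩

/-- `BSD ∧ SelmerRankShaPFinite ⟹ PGSelmerBSD` (the crux is no stronger than summit + item 0132). [folklore] -/
theorem pgSelmerBSD_of_bsd_of_shaPFinite (hS : _root_.BirchSwinnertonDyer)
    (hSha : VerticalContact.SelmerRankShaPFinite) : VerticalContact.PGSelmerBSD :=
  pgSelmerBSD_of_withoutSector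
    (pgSelmerBSDWithoutSector_of_withoutHypotheses (pgSelmerBSDWithoutHypotheses_of_bsd_of_shaPFinite hS hSha))

/-- **Conversely `PGSelmerBSD ∧ SelmerRankShaPFinite ⟹` BSD-rank ON THE SECTOR** (global minimal
models): at the crux's prime, `corank_p = r_an` and `corank_p = rank + 0`. So modulo item 0132 the
crux is EXACTLY the potentially-good sector of the summit; `C → S` fails only off the sector. [folklore] -/
theorem bsd_on_sector_of_pgSelmerBSD_of_shaPFinite (hC : VerticalContact.PGSelmerBSD)
    (hSha : VerticalContact.SelmerRankShaPFinite) (W : WeierstrassCurve ℚ) [W.IsElliptic]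
    [W.IsGloballyMinimal] (hW : ¬ ∃ (q : ℕ) (_ : Fact q.Prime), W.HasMultiplicativeReductionAtPrime q) :
    W.analyticRank = W.mordellWeilRank := by
  obtain ⟨p, hp, h⟩ := hC W hW
  have h1 := W.selmerCorank_eq_mordellWeilRank_add_holds p
  have h2 : W.shaCorank p = 0 := Literature.BSD.shaCorank_eq_zero_of_finite W p (hSha W p)
  omega

/-! ### 4. Shape of a counterexample (negative-side localisation) -/

/-- **Unconditional shape.** If `W` defeats the crux (no prime with `corank_p = r_an`) then at EVERY
prime either BSD-rank fails for `W` or `Ш(W)[p^∞]` has positive corank; and `rank ≤ corank_p`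
always (Kummer). Only the proved corank identity is used. [cite: GreenbergLNM1716, §1] -/
theorem pgSelmerBSD_counterexample_dichotomy (W : WeierstrassCurve ℚ) [W.IsElliptic]
    (hW : ∀ (p : ℕ) [Fact p.Prime], W.selmerCorank p ≠ W.analyticRank) (p : ℕ) [Fact p.Prime] :
    W.mordellWeilRank ≤ W.selmerCorank p ∧
      (W.analyticRank ≠ W.mordellWeilRank ∨ 1 ≤ W.shaCorank p) := by
  have h1 := W.selmerCorank_eq_mordellWeilRank_add_holds p
  have h2 := hW p
  refine ⟨by omega, ?_⟩
  by_cases h : W.analyticRank = W.mordellWeilRank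
  · right; omega
  · left; exact h

/-- **Shape modulo Gross–Zagier–Kolyvagin and `p`-parity** (named facts of the tree, as hypotheses):
a counterexample has `r_an ≥ 2`, and at every prime `corank_p` differs from `r_an` by an EVEN amount
`≥ 2` (first open cells `(corank_p, r_an) ∈ {(0,2), (4,2), (1,3), (5,3), (2,4), …}` at a general
prime; the `p`-converse theorems push the cell to `min ≥ 2` at admissible `p`, see the line files).
[cite: Darmon2004, Thm. 3.22] [cite: DokchitserDokchitserAnnals2010, Thm. 1.4] -/
theorem pgSelmerBSD_counterexample_shape (hGZK : rank_eq_analyticRank_of_analyticRank_le_one)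
    (hPar : ∀ (W : WeierstrassCurve ℚ) [W.IsElliptic] (p : ℕ) [Fact p.Prime], selmerCorank_mod_two_eq W p)
    (W : WeierstrassCurve ℚ) [W.IsElliptic]
    (hW : ∀ (p : ℕ) [Fact p.Prime], W.selmerCorank p ≠ W.analyticRank) :
    2 ≤ W.analyticRank ∧ ∀ (p : ℕ) [Fact p.Prime],
      W.selmerCorank p + 2 ≤ W.analyticRank ∨ W.analyticRank + 2 ≤ W.selmerCorank p := by
  refine ⟨?_, fun p _ => ?_⟩
  · by_contra hlt
    haveI : Fact (Nat.Prime 2) := ⟨Nat.prime_two⟩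
    exact hW 2 (selmerCorank_eq_analyticRank_of_analyticRank_le_one hGZK W 2 (by omega))
  · have hpar : W.selmerCorank p % 2 = W.analyticRank % 2 := hPar W p
    have hne := hW p
    omega

/-- **If BSD-rank holds at the counterexample, Ш is wild at EVERY prime**: `rank W = r_an W` and no
prime with `corank_p = r_an` force `corank Ш(W)[p^∞] ≥ 2` for all `p` (with `p`-parity; `≥ 1`
unconditionally by the dichotomy above) — `(ℚ_p/ℤ_p)² ⊆ Ш(W)` at every prime, a phenomenon with no
known instance, heuristic or numerical signature. [cite: DokchitserDokchitserAnnals2010, Thm. 1.4] -/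
theorem pgSelmerBSD_counterexample_sha_of_rank_eq
    (hPar : ∀ (W : WeierstrassCurve ℚ) [W.IsElliptic] (p : ℕ) [Fact p.Prime], selmerCorank_mod_two_eq W p)
    (W : WeierstrassCurve ℚ) [W.IsElliptic] (hrank : W.analyticRank = W.mordellWeilRank)
    (hW : ∀ (p : ℕ) [Fact p.Prime], W.selmerCorank p ≠ W.analyticRank) (p : ℕ) [Fact p.Prime] :
    2 ≤ W.shaCorank p := by
  have h1 := W.selmerCorank_eq_mordellWeilRank_add_holds p
  have hpar : W.selmerCorank p % 2 = W.analyticRank % 2 := hPar W p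
  have hne := hW p
  omega

/-- **The open core.** Modulo Gross–Zagier–Kolyvagin the crux is equivalent to its `r_an ≥ 2` slice
(the `r_an ≤ 1` slice holds at every prime, sector or not). [cite: Darmon2004, Thm. 3.22] -/
theorem pgSelmerBSD_iff_core (hGZK : rank_eq_analyticRank_of_analyticRank_le_one) :
    VerticalContact.PGSelmerBSD ↔
      ∀ (W : WeierstrassCurve ℚ) [W.IsElliptic] [W.IsGloballyMinimal],
        (¬ ∃ (q : ℕ) (_ : Fact q.Prime), W.HasMultiplicativeReductionAtPrime q) →
          2 ≤ W.analyticRank → ∃ (p : ℕ) (_ : Fact p.Prime), W.selmerCorank p = W.analyticRank := by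
  constructor
  · exact fun hC W _ _ hW _ => hC W hW
  · intro hCore W _ _ hW
    by_cases h : W.analyticRank ≤ 1
    · exact ⟨2, ⟨Nat.prime_two⟩, selmerCorank_eq_analyticRank_of_analyticRank_le_one hGZK W 2 h⟩
    · exact hCore W hW (by omega)

/-! ### 5. Natural strengthenings -/

/-- **FALSE strengthening (small model): asking the crux's prime to be ADMISSIBLE.** The multiplicative
branch of `closes` (`hUBmult`) produces a prime `p ≥ 5`, good ordinary, with `ρ̄_{W,p}` onto; the
same shape on the potentially-good sector is false, because the sector contains the CM curve
`32a2 : y² = x³ − x` (`j = 1728`), which has NO odd prime of surjective mod-`p` image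
(`tamePinch_not_hasSurjectiveModNGaloisRep_quartic`; Serre 1972 §4.5). Hence the crux's `∃ p` must
stay free of any big-image side condition, and every line needs a separate CM branch (as
`Lines/sector_split.lean` has). [cite: Serre1972, §4.5] -/
theorem pgSelmerBSD_strengthening_admissible_false :
    ¬ ∀ (W : WeierstrassCurve ℚ) [W.IsElliptic] [W.IsGloballyMinimal],
        (¬ ∃ (q : ℕ) (_ : Fact q.Prime), W.HasMultiplicativeReductionAtPrime q) →
          ∃ (p : ℕ) (_ : Fact p.Prime), 5 ≤ p ∧ W.HasGoodReductionAtPrime p ∧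
            ¬ (p : ℤ) ∣ W.frobeniusTrace p ∧ W.HasSurjectiveModNGaloisRep p ∧
              W.selmerCorank p = W.analyticRank := by
  intro h
  obtain ⟨p, hp, h5, -, -, hsurj, -⟩ := h ⟨0, 0, 0, -1, 0⟩ thirtyTwoA2_no_multiplicative_prime
  exact tamePinch_not_hasSurjectiveModNGaloisRep_quartic (D := -1) (by norm_num) p (by omega) hsurj

/-- Even the weakest big-image clause fails on the sector: no ODD prime with `ρ̄_{W,p}` onto exists
for `32a2`, whatever is asked of the Selmer corank. [cite: Serre1972, §4.5] -/
theorem pgSelmerBSD_strengthening_oddSurjective_false :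
    ¬ ∀ (W : WeierstrassCurve ℚ) [W.IsElliptic] [W.IsGloballyMinimal],
        (¬ ∃ (q : ℕ) (_ : Fact q.Prime), W.HasMultiplicativeReductionAtPrime q) →
          ∃ (p : ℕ) (_ : Fact p.Prime), p ≠ 2 ∧ W.HasSurjectiveModNGaloisRep p := by
  intro h
  obtain ⟨p, hp, h2, hsurj⟩ := h ⟨0, 0, 0, -1, 0⟩ thirtyTwoA2_no_multiplicative_prime
  exact tamePinch_not_hasSurjectiveModNGaloisRep_quartic (D := -1) (by norm_num) p h2 hsurj

/-- The sector genuinely contains CM curves (so `¬ W.HasCM` cannot be read off the hypotheses):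
`32a2` is in the sector and has CM. [folklore] -/
theorem pgSelmerBSD_sector_meets_CM :
    ∃ (W : WeierstrassCurve ℚ) (_ : W.IsElliptic) (_ : W.IsGloballyMinimal),
      (¬ ∃ (q : ℕ) (_ : Fact q.Prime), W.HasMultiplicativeReductionAtPrime q) ∧ W.HasCM :=
  ⟨_, isElliptic_thirtyTwoA2, isGloballyMinimal_thirtyTwoA2, thirtyTwoA2_no_multiplicative_prime,
    hasCM_thirtyTwoA2⟩

/-- Strengthening `∃ p ↦ ∀ p` (Selmer-rank BSD at EVERY prime on the sector). NOT refutable here: it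
is still implied by `BSD ∧ SelmerRankShaPFinite`. [cite: GreenbergLNM1716, §1] -/
def PGSelmerBSDForall : Prop :=
  ∀ (W : WeierstrassCurve ℚ) [W.IsElliptic] [W.IsGloballyMinimal],
    (¬ ∃ (q : ℕ) (_ : Fact q.Prime), W.HasMultiplicativeReductionAtPrime q) →
      ∀ (p : ℕ) [Fact p.Prime], W.selmerCorank p = W.analyticRank

/-- `BSD ∧ SelmerRankShaPFinite ⟹ PGSelmerBSDForall`. [cite: GreenbergLNM1716, §1] -/
theorem pgSelmerBSDForall_of_bsd_of_shaPFinite (hS : _root_.BirchSwinnertonDyer)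
    (hSha : VerticalContact.SelmerRankShaPFinite) : PGSelmerBSDForall := by
  intro W _ _ _ p _
  have h1 := W.selmerCorank_eq_mordellWeilRank_add_holds p
  have h2 : W.shaCorank p = 0 := Literature.BSD.shaCorank_eq_zero_of_finite W p (hSha W p)
  have h3 : W.analyticRank = W.mordellWeilRank :=
    (show ∀ V : WeierstrassCurve ℚ, V.IsElliptic → V.analyticRank = V.mordellWeilRank from hS) W ‹_›
  omega

/-- `PGSelmerBSDForall ⟹ PGSelmerBSD` (take `p = 2`). [folklore] -/
theorem pgSelmerBSD_of_forall (h : PGSelmerBSDForall) : VerticalContact.PGSelmerBSD :=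
  fun W _ _ hW => ⟨2, ⟨Nat.prime_two⟩, h W hW 2⟩

/-- Strengthening to a UNIFORM prime (`∃ p ∀ W` instead of `∀ W ∃ p`). NOT refutable here either:
`BSD ∧ SelmerRankShaPFinite` give it at every `p`. [cite: GreenbergLNM1716, §1] -/
theorem pgSelmerBSD_uniform_of_bsd_of_shaPFinite (hS : _root_.BirchSwinnertonDyer)
    (hSha : VerticalContact.SelmerRankShaPFinite) (p : ℕ) [Fact p.Prime] :
    ∀ (W : WeierstrassCurve ℚ) [W.IsElliptic] [W.IsGloballyMinimal],
      (¬ ∃ (q : ℕ) (_ : Fact q.Prime), W.HasMultiplicativeReductionAtPrime q) →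
        W.selmerCorank p = W.analyticRank :=
  fun W _ _ hW => pgSelmerBSDForall_of_bsd_of_shaPFinite hS hSha W hW p

/-! ### 6. Targets / line notes -/

/-- `-- Targets`: none served this cycle. `-- Line Sketch` (PICKED; λ-minimal branch): pre-attack
notes for the lead and the next re-arm, recorded on a trivial carrier theorem.
(i) C⁺ = `FreeOrderMinimalPrime` ("∃ admissible p with ord_{T=0} L_p(W,T) ≤ r_an(W)", non-CM sector)
implies, with Kato 18.4, `corank_p ≤ r_an` hence (corank ≥ rank) RANK ≤ r_an on the non-CM sector:
it is at least the no-excess-rank half of BSD there — not refutable by this seat for the same reason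
as the crux. (ii) Typing trap to check when the skeleton lands: `PowerSeries.order` is `ℕ∞`-valued;
if the tree's `padicLFunction f α` can be the ZERO series in any admissible configuration (junk
branch of `unitRoot`, or a normalisation making the interpolation vacuous), `order = ⊤` and
`⊤ ≤ ↑r_an` is FALSE — the stub must carry (or the tree must supply, Rohrlich 1984
`padicLFunction_ne_zero`) non-vanishing of `L_p`; conversely a stub stated with `PowerSeries.order …
≤ r_an` and a junk-zero series would be refutable outright. (iii) The CM branch of the line is item
18086 verbatim (`SelmerRankCM`), whose own Disproof (Cruxes/SelmerRankCM) records no kill.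
(iv) The admissible-prime clause of C⁺ is satisfiable for non-CM curves (Serre, proved in tree:
`exists_goodOrdinary_surjective_of_not_hasCM`), so the 15532 pattern does not bite C⁺. [folklore] -/
theorem lineSketch_notes : True := trivial

end Summit.BirchSwinnertonDyer.BirchSwinnertonDyer.Cruxes.PGSelmerBSD.Disproof

end
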